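import Summits.Ventures.HSemireg.WedgeHankelRecurrencePeriodFinite
import Summits.Ventures.HSemireg.WedgeHankelRecurrenceSymbol

/-!
# Venture HSemireg — THE PERIOD OF A SUM: for monic `m`, `m′` that are COPRIME and reduced fractions `a/m`, `a′/m′`, the sum of dual classes `dualSeq m a + dualSeq m′ a′` is the class of
# `(a m′ + a′ m)/(m m′)` (N45), so **its periods are the multiples of `lcm(ord(m), ord(m′))` and over a finite field (non-singular feedback) its least period IS `lcm(ord(m), ord(m′))`**
# («the least period of the sum of two LFSR sequences with coprime minimal polynomials is the lcm of their least periods», Lidl–Niederreiter Thm 3.9 with Ch. 8)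

HONEST FRAMING. Part of the Lean index of the computation cell `pub-hsemireg` (seat p10 gen 30, Sunday typer «UNIFORM-IN-n»).
LINEAR ALGEBRA OF HANKEL (catalecticant) MATRICES and of polynomials over a field ONLY: no variety, no cohomology theory, no sheaf, no Ext group and no semiregularity map is constructed
here; nothing here says that HC / HC_CM / HC_AV holds.  No unproved named fact is used: the PROVED Literature module `Literature.Algebra.Polynomial.OrderOfPolynomial` (Lidl–Niederreiter Thm 3.9
`polOrd_mul : IsCoprime g₁ g₂ → polOrd (g₁ * g₂) = Nat.lcm (polOrd g₁) (polOrd g₂)`) is imported (through N85) and nothing of it is restated.  Custodian versions as in `WedgeHankelSiegelIdeal` (1/3).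

WHAT IS IN THE TREE.  N45 (`WedgeHankelRecurrenceSymbol`): `dualSeq_add_dualSeq` (`dualSeq m a + dualSeq m′ a′ = dualSeq (m m′) (a m′ + a′ m)`), `isCoprime_mul_add_mul`.  N85 (`WedgeHankelRecurrencePeriodFinite`):
`periodic_dualSeq_iff_polOrd_dvd`, `periodic_dualSeq_of_polOrd_dvd`, `isLeast_setOf_periodic_dualSeq`.  Literature: `polOrd_mul`.  Mathlib: `Polynomial.Monic.mul`, `Polynomial.mul_coeff_zero`.
THIS FILE (namespace `Summit.Ventures.HSemireg.Wedge.HankelOuter` continued; CHAINED on N85 (+ TREE N45); 0 definitions):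
* §644 **`periodic_dualSeq_add_dualSeq_iff_lcm_dvd`** (any field; `m ⊥ m′`, `m ⊥ a`, `m′ ⊥ a′`: the sum is `T`-periodic ↔ `lcm(ord m, ord m′) ∣ T`), `periodic_dualSeq_add_dualSeq_of_dvd_of_dvd` (any common
  period-multiple `ord m ∣ T`, `ord m′ ∣ T` is a period of the sum — no coprimality at all), **`isLeast_setOf_periodic_dualSeq_add_dualSeq`** (finite field, `m(0) m′(0) ≠ 0`: THE LEAST PERIOD OF
  THE SUM IS `lcm(ord m, ord m′)`).
Nothing Ext-side.  New names only.
-/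

open Module Polynomial
open scoped Matrix Polynomial

namespace Summit.Ventures.HSemireg.Wedge.HankelOuter

open Summit.Ventures.HSemireg.Wedge Summit.Ventures.HSemireg.Wedge.Hankel
open Literature.Algebra.Polynomial.OrderOfPolynomial

variable (K : Type*) [Field K]

/-! ## §644. The period of a sum -/

/-- **the periods of `dualSeq m a + dualSeq m′ a′` (`m`, `m′` monic and coprime, `a/m` and `a′/m′` reduced) are exactly the multiples of `lcm(ord(m), ord(m′))`** (any field: the sum is
the reduced class `(a m′ + a′ m)/(m m′)` and `ord(m m′) = lcm(ord m, ord m′)`). -/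
theorem periodic_dualSeq_add_dualSeq_iff_lcm_dvd {m m' a a' : K[X]} (hm : m.Monic) (hm' : m'.Monic) (hmm' : IsCoprime m m') (hma : IsCoprime m a) (hm'a' : IsCoprime m' a')
    (T : ℕ) : Function.Periodic (dualSeq K m a + dualSeq K m' a') T ↔ Nat.lcm (polOrd m) (polOrd m') ∣ T := by
  rw [dualSeq_add_dualSeq K hm hm' a a', periodic_dualSeq_iff_polOrd_dvd K (hm.mul hm') (isCoprime_mul_add_mul K hmm' hma hm'a') T, polOrd_mul hmm']

/-- a common multiple of `ord(m)` and `ord(m′)` is a period of `dualSeq m a + dualSeq m′ a′` (`m`, `m′` monic; no coprimality needed anywhere). -/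
theorem periodic_dualSeq_add_dualSeq_of_dvd_of_dvd {m m' : K[X]} (hm : m.Monic) (hm' : m'.Monic) (a a' : K[X]) {T : ℕ} (h : polOrd m ∣ T) (h' : polOrd m' ∣ T) :
    Function.Periodic (dualSeq K m a + dualSeq K m' a') T :=
  (periodic_dualSeq_of_polOrd_dvd K hm a h).add (periodic_dualSeq_of_polOrd_dvd K hm' a' h')

/-- **THE LEAST PERIOD OF A SUM IS THE LCM**: over a finite field, for `m`, `m′` monic, coprime, with `m(0) ≠ 0 ≠ m′(0)`, and reduced fractions `a/m`, `a′/m′`, the least positive period of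
`dualSeq m a + dualSeq m′ a′` is `lcm(ord(m), ord(m′))` — the lcm of the least periods of the summands (N85). -/
theorem isLeast_setOf_periodic_dualSeq_add_dualSeq [Finite K] {m m' a a' : K[X]} (hm : m.Monic) (hm' : m'.Monic) (hmm' : IsCoprime m m') (hma : IsCoprime m a)
    (hm'a' : IsCoprime m' a') (h0 : m.coeff 0 ≠ 0) (h0' : m'.coeff 0 ≠ 0) :
    IsLeast {T : ℕ | 0 < T ∧ Function.Periodic (dualSeq K m a + dualSeq K m' a') T} (Nat.lcm (polOrd m) (polOrd m')) := by
  rw [dualSeq_add_dualSeq K hm hm' a a', ← polOrd_mul hmm']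
  exact isLeast_setOf_periodic_dualSeq K (hm.mul hm') (isCoprime_mul_add_mul K hmm' hma hm'a') (by rw [Polynomial.mul_coeff_zero]; exact mul_ne_zero h0 h0')

end Summit.Ventures.HSemireg.Wedge.HankelOuter
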